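import Mathlib
import Literature.NumberTheory.LFunctions.Zhang2022.Section12Eq1212Integral
import Literature.NumberTheory.LFunctions.Zhang2022.TypedSection12B
import Literature.NumberTheory.LFunctions.Zhang2022.Section12Ded1217Sizes
import Literature.NumberTheory.LFunctions.Zhang2022.Section10CRanges1422
import Literature.NumberTheory.LFunctions.Zhang2022.Section9FrontEndExact
import HarnessLib

/-!
# Zhang (2022) §12 (12.12), first equality — the pieces: the `(d,r)`-sum of `S_j(𝐚₁₂,𝐚₂₅)|_{dr≤P″₁/T}`
# re-indexed by `n = dr`, the printed profile `ῑ₃𝓕_{j6}(P^{0.498}/n)/0.498 + ῑ₄𝓕_{j7}(P^{0.5}/n)/0.5`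
# against Lemma 8.2's `P₃, P₂`-profile, and the shape of the printed main term

Topic `Literature/NumberTheory/LFunctions/Zhang2022` (Landau–Siegel audit tree; verdict-neutral).
Y. Zhang, *Discrete mean estimates and the Landau–Siegel zero*, arXiv:2211.02515v1 (2022)
[Zhang2022LandauSiegel] — **an unrefereed manuscript under adjudication; this theorem-only file proves
elementary identities and sizes of its own typed objects and asserts nothing about its Theorems 1–2.**
ZHANG-L discharge lane (WP12, seat zl-w12-p10), leaf `Typed.Sec12C.Eq1212 c′` (`h1212` of
`Skeleton.theorem1_of_leaves_v19`), node `Z22:(12.12)` [Z22 p.71, tex L3605–L3612]: "By Lemma 8.2, 8.3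
and 12.2, the sum over `dr ≤ P″₁/T` is equal to `L′(1,χ)²b*β_{j+1}β_{j+2}Σ_{n<P^{0.496}}|χ(n)|λ₀ⱼ(n)φ(n)⁻¹
(ῑ₃𝓕_{j6}(P^{0.498}/n)/0.498 + ῑ₄𝓕_{j7}(P^{0.5}/n)/0.5) + o(α)`". The companion
`Section12Eq1212Holds` assembles these pieces with Lemma 12.2 (typed `Typed.Sec12B.Lemma122`) into the
first equality; the second equality is `Section12Eq1212Integral` (landed).

| decl | content |
|---|---|
| `norm_frakfW7_P2_sub_le`, `norm_F_sub_Fpr_le`, `norm_Fpr_le` | the `m`-side profile: Lemma 8.2's `ῑ₃(log P₃)⁻¹𝓕_{j6}(P₃/n) + ῑ₄(log P₂)⁻¹𝓕_{j7}(P₂/n)` versus the PRINTED `(ῑ₃𝓕_{j6}(P^{0.498}/n)/0.498 + ῑ₄𝓕_{j7}(P^{0.5}/n)/0.5)/log P` (`P₃ = P^{0.498}` exactly; `P₂ = P^{0.5}T^{−10}` costs `O(𝓛^{1.1}𝓛⁻¹⁸)` — the `𝓕`-twin of the tree's `Ranges1422.norm_G_sub_Gpr_le`), and `‖printed profile‖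 ≤ 29(‖ι₃‖/0.498 + ‖ι₄‖/0.5)` |
| `natAbs_moebius_eq_ite`, `nsum_a25_eq_sum122` | `|μ(r)| = [r squarefree]`; the `n`-sum of `S_j(𝐚₁₂,𝐚₂₅)` at `(d,r)` is `χ(dr)·Σ_lχ(l)ϰ̄₁₃(drl)ξ₀ⱼ(l;d,r)/l` = `χ(dr)·sum122` (Lemma 12.2's sum, `Typed.Sec12B.sum122`) |
| `SjOn_a12_a25_eq_divisor_sum` | `S_j(𝐚₁₂,𝐚₂₅)|_R = Σ_{n: R(n)} Σ_{r∣n sqfree} a(n)φ(r)⁻¹·M(n)·sum122(n/r, r)`, `a(n) = |χ(n)|λ₀ⱼ(n)/n`, `M(n) = ῑ₃Σ_mχ(m)ϰ₃(nm)m^{β_j−1} + ῑ₄Σ_mχ(m)ϰ₂(nm)m^{β_j−1}` (substitution `n = dr`, `Skeleton.sum_box_ite_eq_sum_divisors`; `χ(dr)² = |χ(dr)|`) |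
| `main1212sum_eq_sum` | the printed main term as `L′²b*β_{j+1}β_{j+2}·Σ_{1≤n<⌈P^{0.496}⌉}|χ(n)|λ₀ⱼ(n)φ(n)⁻¹F_pr(n)` |
| `sum_Icc_ratio7_le'` | `Σ_{n≤X}(n/φ(n))⁷/n ≤ 1 + e²⁵⁶(1 + log X)` (the tree's `sum_ratio_pow_div_le`) |

No definitions, no new facts; standard axioms.

## References

* Y. Zhang, arXiv:2211.02515v1 (2022), §12 (12.12) p.71, Lemma 12.2 (12.10) p.69; §9 (9.2);
  §8 (8.6), Lemma 8.2, (8.10); §2 (2.21), (2.26). [cite: Zhang2022LandauSiegel, §12 (12.12) p.71]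
* R. R. Hall, G. Tenenbaum, *Divisors*, CUP 1988, §0.2. [cite: HallTenenbaum1988, §0.2]
-/

noncomputable section

open Complex Real ComplexConjugate
open Literature.NumberTheory.LFunctions.Zhang2022.Skeleton

namespace Literature.NumberTheory.LFunctions.Zhang2022.Typed.Sec12C

open Literature.NumberTheory.LFunctions.Zhang2022.Typed.Sec10C.Ranges1422

/-! ## The printed `m`-side profile versus Lemma 8.2's profile -/

section Bridge

variable (c' : ℝ) {D : ℕ}

/-- `log(P^a/m) = a𝓛⁹ − log m` (`m > 0`). [cite: Zhang2022LandauSiegel, §2 (2.6)] -/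
theorem log_rpow_div (a : ℝ) {m : ℝ} (hm : 0 < m) :
    Real.log (bigP D ^ a / m) = a * ell D ^ 9 - Real.log m := by
  rw [Real.log_div (bigP_rpow_pos D a).ne' hm.ne', Real.log_rpow (Skeleton.bigP_pos D), log_bigP]

/-- **Lipschitz step for `𝓕_{j7}`**: `‖𝓕_{j7}(P₂/m) − 𝓕_{j7}(P^{0.5}/m)‖ ≤ 94α·10𝓛^{1.1}` for
`1 ≤ m ≤ P^{0.5}` (`log(P^{0.5}/m) − log(P₂/m) = 10𝓛^{1.1}`, `‖𝔣′‖ ≤ 94α` on `α|L| ≤ 4`,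
`Section8AbelProfiles.norm_frakf_le`; the `𝓕`-twin of `Ranges1422.norm_frakgW7_P2_sub_le`).
[cite: Zhang2022LandauSiegel, §8 Lemma 8.2; §2 (2.21)] -/
theorem norm_frakfW7_P2_sub_le (hℓ : 3 ≤ ell D) (hc5 : 5 * |c'| * alpha D * ell D ≤ 1) (j : ℕ)
    {m : ℝ} (hm1 : 1 ≤ m) (hmP : m ≤ bigP D ^ (0.5 : ℝ)) :
    ‖frakfW c' D j 7 (Skeleton.P2 D / m) - frakfW c' D j 7 (bigP D ^ (0.5 : ℝ) / m)‖ ≤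
      94 * alpha D * (10 * ell D ^ (1.1 : ℝ)) := by
  obtain ⟨hα, hαeq, hαℓ⟩ := alpha_facts hℓ
  have hℓ0 : 0 < ell D := by linarith
  have hℓ1 : 1 ≤ ell D := by linarith
  have hm0 : 0 < m := by linarith
  set βj := betaJ c' D j
  set βμ := betaMu D 7
  set L₁ := Real.log (Skeleton.P2 D / m) with hL₁
  set L₂ := Real.log (bigP D ^ (0.5 : ℝ) / m) with hL₂
  have hdiff : L₂ - L₁ = 10 * ell D ^ (1.1 : ℝ) := log_half_div_sub_log_P2_div hm0
  have h11pos : 0 ≤ ell D ^ (1.1 : ℝ) := Real.rpow_nonneg hℓ0.le _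
  have hle : L₁ ≤ L₂ := by linarith
  have hL₂le : L₂ ≤ 0.5 * ell D ^ 9 := by
    rw [hL₂, log_rpow_div (0.5 : ℝ) hm0]
    linarith [Real.log_nonneg hm1]
  have hL₁ge : -(ell D ^ 9) ≤ L₁ := by
    have h11 : ell D ^ (1.1 : ℝ) ≤ ell D ^ 2 := by
      have h : ell D ^ (1.1 : ℝ) ≤ ell D ^ (2 : ℝ) :=
        Real.rpow_le_rpow_of_exponent_le hℓ1 (by norm_num)
      simpa using h
    have h7 : (3 : ℝ) ^ 7 ≤ ell D ^ 7 := pow_le_pow_left₀ (by norm_num) hℓ 7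
    have hL₂ge : 0 ≤ L₂ := by
      rw [hL₂]; exact Real.log_nonneg (by rw [le_div_iff₀ hm0]; linarith)
    nlinarith [pow_nonneg hℓ0.le 2]
  set f : ℝ → ℂ := fun L => frakf βj βμ (L : ℂ) with hf
  set f' : ℝ → ℂ := fun L => cexp (βμ * (L : ℂ)) * ((βμ - βj) + (1 + (βμ - βj) * (L : ℂ)) * βμ)
    with hf'
  have hderiv : ∀ x ∈ Set.Icc L₁ L₂, HasDerivWithinAt f (f' x) (Set.Icc L₁ L₂) x := by
    intro x _
    exact ((Section8AbelProfiles.hasDerivAt_frakf βj βμ (x : ℂ)).comp_ofReal).hasDerivWithinAt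
  have hbound : ∀ x ∈ Set.Ico L₁ L₂, ‖f' x‖ ≤ 94 * alpha D := by
    intro x hx
    have hxabs : alpha D * |x| ≤ 4 := by
      have : |x| ≤ ell D ^ 9 := abs_le.mpr ⟨by linarith [hx.1], by linarith [hx.2]⟩
      calc alpha D * |x| ≤ alpha D * ell D ^ 9 := by gcongr
        _ = π := hαℓ
        _ ≤ 4 := by linarith [Real.pi_lt_d2]
    have hμb := Section8AbelProfiles.norm_betaMu_bounds hα.le 7
    have hμ3 : ‖βμ‖ ≤ 3 * alpha D := hμb.2
    exact (Section8AbelProfiles.norm_frakf_le (L := x) (Section8AbelProfiles.betaMu_re D 7) hμ3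
      (Section8AbelProfiles.norm_betaJ_le c' hα.le hℓ0.le hc5 j) hxabs).2
  have key := norm_image_sub_le_of_norm_deriv_le_segment' hderiv hbound L₂
    (Set.right_mem_Icc.mpr hle)
  rw [hdiff] at key
  have e1 : frakfW c' D j 7 (Skeleton.P2 D / m) = f L₁ := rfl
  have e2 : frakfW c' D j 7 (bigP D ^ (0.5 : ℝ) / m) = f L₂ := rfl
  rw [e1, e2, norm_sub_rev]
  linarith

/-- `‖𝓕_{jμ}(Q/t)‖ ≤ 29` for `Q, t ∈ [1, P]`, once `5|c′|α𝓛 ≤ 1` (`α log P = π ≤ 4`;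
`Section8AbelProfiles.frakfW_div_bounds`). [cite: Zhang2022LandauSiegel, §8 Lemma 8.2] -/
theorem norm_frakfW_div_le (hℓ : 3 ≤ ell D) (hc5 : 5 * |c'| * alpha D * ell D ≤ 1) (j μ : ℕ)
    {Q t : ℝ} (hQ1 : 1 ≤ Q) (hQP : Q ≤ bigP D) (ht1 : 1 ≤ t) (htP : t ≤ bigP D) :
    ‖frakfW c' D j μ (Q / t)‖ ≤ 29 := by
  obtain ⟨hα, -, hαℓ⟩ := alpha_facts hℓ
  have hT : alpha D * Real.log (bigP D) ≤ 4 := by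
    rw [log_bigP, hαℓ]; linarith [Real.pi_lt_d2]
  exact (Section8AbelProfiles.frakfW_div_bounds c' j μ hα (by linarith) hc5 hQ1 hQP ht1 htP hT).2.1

/-- **The printed profile versus Lemma 8.2's**: for `1 ≤ m ≤ P^{0.5}` (and `𝓛 ≥ 3`, `5|c′|α𝓛 ≤ 1`),
`‖ῑ₃(log P₃)⁻¹𝓕_{j6}(P₃/m) + ῑ₄(log P₂)⁻¹𝓕_{j7}(P₂/m) − (ῑ₃𝓕_{j6}(P^{0.498}/m)/0.498 +
ῑ₄𝓕_{j7}(P^{0.5}/m)/0.5)/log P‖ ≤ 25000·𝓛^{1.1}·𝓛⁻¹⁸` (the `ι₃` parts agree since `P₃ = P^{0.498}`; the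
`ι₄` parts differ by the Lipschitz step and by `(log P₂)⁻¹ − (0.5 log P)⁻¹ ≤ 50𝓛^{1.1}𝓛⁻¹⁸`).
[cite: Zhang2022LandauSiegel, §12 (12.12) p.71; §2 (2.21)] -/
theorem norm_F_sub_Fpr_le (hℓ : 3 ≤ ell D) (hc5 : 5 * |c'| * alpha D * ell D ≤ 1) (j : ℕ)
    {m : ℝ} (hm1 : 1 ≤ m) (hmP : m ≤ bigP D ^ (0.5 : ℝ)) :
    ‖(conj iota3 * (Real.log (Skeleton.P3 D) : ℂ)⁻¹ * frakfW c' D j 6 (Skeleton.P3 D / m) +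
        conj iota4 * (Real.log (Skeleton.P2 D) : ℂ)⁻¹ * frakfW c' D j 7 (Skeleton.P2 D / m)) -
      (conj iota3 * frakfW c' D j 6 (bigP D ^ (0.498 : ℝ) / m) / 0.498 +
        conj iota4 * frakfW c' D j 7 (bigP D ^ (0.5 : ℝ) / m) / 0.5) / (Real.log (bigP D) : ℂ)‖ ≤
      25000 * ell D ^ (1.1 : ℝ) * (ell D ^ 18)⁻¹ := by
  obtain ⟨hα, hαeq, hαℓ⟩ := alpha_facts hℓ
  have hℓ0 : 0 < ell D := by linarith
  have hℓ1 : 1 ≤ ell D := by linarith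
  have hm0 : 0 < m := by linarith
  obtain ⟨hP2lo, hP2hi⟩ := log_P2_bounds (D := D) hℓ
  have hP2 : 0 < Real.log (Skeleton.P2 D) := log_P2_pos hℓ
  have h11pos : 0 ≤ ell D ^ (1.1 : ℝ) := Real.rpow_nonneg hℓ0.le _
  have hi4 : ‖conj iota4‖ ≤ 2.3 := by rw [Complex.norm_conj]; exact Sec10C.norm_iota34_le.2
  set g6 := frakfW c' D j 6 (Skeleton.P3 D / m)
  set g7 := frakfW c' D j 7 (Skeleton.P2 D / m)
  set g7' := frakfW c' D j 7 (bigP D ^ (0.5 : ℝ) / m)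
  have hP3def : bigP D ^ (0.498 : ℝ) = Skeleton.P3 D := rfl
  rw [hP3def]
  have hlogP : (Real.log (bigP D) : ℂ) = ((ell D ^ 9 : ℝ) : ℂ) := by rw [log_bigP]
  have hlogP3 : (Real.log (Skeleton.P3 D) : ℂ) = (0.498 : ℂ) * ((ell D ^ 9 : ℝ) : ℂ) := by
    rw [log_P3_eq]; push_cast; ring
  have hℓ9 : ((ell D ^ 9 : ℝ) : ℂ) ≠ 0 := by exact_mod_cast (by positivity : ell D ^ 9 ≠ 0)
  have hlp2 : (Real.log (Skeleton.P2 D) : ℂ) ≠ 0 := by exact_mod_cast hP2.ne'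
  have hhalf9 : (((0.5 * ell D ^ 9 : ℝ)) : ℂ) ≠ 0 := by
    exact_mod_cast (by positivity : 0.5 * ell D ^ 9 ≠ 0)
  have e : (conj iota3 * (Real.log (Skeleton.P3 D) : ℂ)⁻¹ * g6 +
        conj iota4 * (Real.log (Skeleton.P2 D) : ℂ)⁻¹ * g7) -
      (conj iota3 * g6 / 0.498 + conj iota4 * g7' / 0.5) / (Real.log (bigP D) : ℂ) =
      conj iota4 * ((Real.log (Skeleton.P2 D) : ℂ)⁻¹ * (g7 - g7') +
        g7' * ((Real.log (Skeleton.P2 D) : ℂ)⁻¹ - (((0.5 * ell D ^ 9 : ℝ)) : ℂ)⁻¹)) := by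
    rw [hlogP, hlogP3]
    push_cast
    field_simp
    ring
  rw [e]
  have hP1 : 1 ≤ bigP D := Sec10C.one_le_bigP D
  have hhalfP : bigP D ^ (0.5 : ℝ) ≤ bigP D := by
    calc bigP D ^ (0.5 : ℝ) ≤ bigP D ^ (1 : ℝ) := Real.rpow_le_rpow_of_exponent_le hP1 (by norm_num)
      _ = bigP D := Real.rpow_one _
  have h1half : 1 ≤ bigP D ^ (0.5 : ℝ) := Real.one_le_rpow hP1 (by norm_num)
  have hg7' : ‖g7'‖ ≤ 29 := norm_frakfW_div_le c' hℓ hc5 j 7 h1half hhalfP hm1 (hmP.trans hhalfP)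
  have hlip := norm_frakfW7_P2_sub_le c' hℓ hc5 j hm1 hmP
  have ninv : ‖(Real.log (Skeleton.P2 D) : ℂ)⁻¹‖ = (Real.log (Skeleton.P2 D))⁻¹ := by
    rw [norm_inv, Complex.norm_real, Real.norm_eq_abs, abs_of_pos hP2]
  have hsub0 : 0 ≤ (Real.log (Skeleton.P2 D))⁻¹ - (0.5 * ell D ^ 9)⁻¹ := by
    rw [sub_nonneg]; exact inv_anti₀ hP2 hP2hi
  have ndiff : ‖(Real.log (Skeleton.P2 D) : ℂ)⁻¹ - (((0.5 * ell D ^ 9 : ℝ)) : ℂ)⁻¹‖ =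
      (Real.log (Skeleton.P2 D))⁻¹ - (0.5 * ell D ^ 9)⁻¹ := by
    have : (Real.log (Skeleton.P2 D) : ℂ)⁻¹ - (((0.5 * ell D ^ 9 : ℝ)) : ℂ)⁻¹ =
        (((Real.log (Skeleton.P2 D))⁻¹ - (0.5 * ell D ^ 9)⁻¹ : ℝ) : ℂ) := by push_cast; ring
    rw [this, Complex.norm_real, Real.norm_eq_abs, abs_of_nonneg hsub0]
  have hinvdiff : (Real.log (Skeleton.P2 D))⁻¹ - (0.5 * ell D ^ 9)⁻¹ ≤
      50 * ell D ^ (1.1 : ℝ) * (ell D ^ 18)⁻¹ := by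
    have hprod : 0.2 * ell D ^ 18 ≤ Real.log (Skeleton.P2 D) * (0.5 * ell D ^ 9) := by nlinarith
    have eq1 : (Real.log (Skeleton.P2 D))⁻¹ - (0.5 * ell D ^ 9)⁻¹ =
        (0.5 * ell D ^ 9 - Real.log (Skeleton.P2 D)) / (Real.log (Skeleton.P2 D) * (0.5 * ell D ^ 9)) :=
      inv_sub_inv hP2.ne' (by positivity)
    rw [eq1, log_P2_eq, show 0.5 * ell D ^ 9 - (0.5 * ell D ^ 9 - 10 * ell D ^ (1.1 : ℝ)) =
      10 * ell D ^ (1.1 : ℝ) by ring, ← log_P2_eq]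
    rw [div_le_iff₀ (by positivity)]
    calc 10 * ell D ^ (1.1 : ℝ) = 50 * ell D ^ (1.1 : ℝ) * (ell D ^ 18)⁻¹ * (0.2 * ell D ^ 18) := by
          field_simp; ring
      _ ≤ 50 * ell D ^ (1.1 : ℝ) * (ell D ^ 18)⁻¹ * (Real.log (Skeleton.P2 D) * (0.5 * ell D ^ 9)) := by
          gcongr
  have hinvle : (Real.log (Skeleton.P2 D))⁻¹ ≤ (0.4 * ell D ^ 9)⁻¹ := inv_anti₀ (by positivity) hP2lo
  calc ‖conj iota4 * ((Real.log (Skeleton.P2 D) : ℂ)⁻¹ * (g7 - g7') +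
          g7' * ((Real.log (Skeleton.P2 D) : ℂ)⁻¹ - (((0.5 * ell D ^ 9 : ℝ)) : ℂ)⁻¹))‖
      = ‖conj iota4‖ * ‖(Real.log (Skeleton.P2 D) : ℂ)⁻¹ * (g7 - g7') +
          g7' * ((Real.log (Skeleton.P2 D) : ℂ)⁻¹ - (((0.5 * ell D ^ 9 : ℝ)) : ℂ)⁻¹)‖ := norm_mul _ _
    _ ≤ ‖conj iota4‖ * (‖(Real.log (Skeleton.P2 D) : ℂ)⁻¹ * (g7 - g7')‖ +
          ‖g7' * ((Real.log (Skeleton.P2 D) : ℂ)⁻¹ - (((0.5 * ell D ^ 9 : ℝ)) : ℂ)⁻¹)‖) := by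
        gcongr; exact norm_add_le _ _
    _ = ‖conj iota4‖ * ((Real.log (Skeleton.P2 D))⁻¹ * ‖g7 - g7'‖ +
          ‖g7'‖ * ((Real.log (Skeleton.P2 D))⁻¹ - (0.5 * ell D ^ 9)⁻¹)) := by
        rw [norm_mul, norm_mul, ninv, ndiff]
    _ ≤ 2.3 * ((0.4 * ell D ^ 9)⁻¹ * (94 * alpha D * (10 * ell D ^ (1.1 : ℝ))) +
          29 * (50 * ell D ^ (1.1 : ℝ) * (ell D ^ 18)⁻¹)) := by
        gcongr
    _ = ell D ^ (1.1 : ℝ) * (ell D ^ 18)⁻¹ * (2.3 * (2350 * π + 1450)) := by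
        rw [hαeq]; field_simp; ring
    _ ≤ ell D ^ (1.1 : ℝ) * (ell D ^ 18)⁻¹ * 25000 := by
        gcongr; nlinarith [Real.pi_lt_d2]
    _ = 25000 * ell D ^ (1.1 : ℝ) * (ell D ^ 18)⁻¹ := by ring

/-- **Size of the printed profile**: `‖ῑ₃𝓕_{j6}(P^{0.498}/m)/0.498 + ῑ₄𝓕_{j7}(P^{0.5}/m)/0.5‖ ≤
29(1.25/0.498 + 2.3/0.5)` for `1 ≤ m ≤ P^{0.498}` (so both arguments lie in `[1, P]`).
[cite: Zhang2022LandauSiegel, §12 (12.12) p.71] -/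
theorem norm_Fpr_le (hℓ : 3 ≤ ell D) (hc5 : 5 * |c'| * alpha D * ell D ≤ 1) (j : ℕ)
    {m : ℝ} (hm1 : 1 ≤ m) (hmP : m ≤ bigP D ^ (0.498 : ℝ)) :
    ‖conj iota3 * frakfW c' D j 6 (bigP D ^ (0.498 : ℝ) / m) / 0.498 +
        conj iota4 * frakfW c' D j 7 (bigP D ^ (0.5 : ℝ) / m) / 0.5‖ ≤
      29 * (1.25 / 0.498 + 2.3 / 0.5) := by
  have hP1 : 1 ≤ bigP D := Sec10C.one_le_bigP D
  have h498 : 1 ≤ bigP D ^ (0.498 : ℝ) := Real.one_le_rpow hP1 (by norm_num)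
  have h5 : 1 ≤ bigP D ^ (0.5 : ℝ) := Real.one_le_rpow hP1 (by norm_num)
  have h498P : bigP D ^ (0.498 : ℝ) ≤ bigP D := by
    calc bigP D ^ (0.498 : ℝ) ≤ bigP D ^ (1 : ℝ) := Real.rpow_le_rpow_of_exponent_le hP1 (by norm_num)
      _ = bigP D := Real.rpow_one _
  have h5P : bigP D ^ (0.5 : ℝ) ≤ bigP D := by
    calc bigP D ^ (0.5 : ℝ) ≤ bigP D ^ (1 : ℝ) := Real.rpow_le_rpow_of_exponent_le hP1 (by norm_num)
      _ = bigP D := Real.rpow_one _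
  have hmP' : m ≤ bigP D := hmP.trans h498P
  have n6 := norm_frakfW_div_le c' hℓ hc5 j 6 h498 h498P hm1 hmP'
  have n7 := norm_frakfW_div_le c' hℓ hc5 j 7 h5 h5P hm1 hmP'
  obtain ⟨hi3, hi4⟩ := Sec10C.norm_iota34_le
  have hc3 : ‖conj iota3‖ ≤ 1.25 := by rw [Complex.norm_conj]; exact hi3
  have hc4 : ‖conj iota4‖ ≤ 2.3 := by rw [Complex.norm_conj]; exact hi4
  have n498 : ‖(0.498 : ℂ)‖ = 0.498 := by
    rw [show (0.498 : ℂ) = ((0.498 : ℝ) : ℂ) by norm_num, Complex.norm_real]; norm_num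
  have n5 : ‖(0.5 : ℂ)‖ = 0.5 := by
    rw [show (0.5 : ℂ) = ((0.5 : ℝ) : ℂ) by norm_num, Complex.norm_real]; norm_num
  calc ‖conj iota3 * frakfW c' D j 6 (bigP D ^ (0.498 : ℝ) / m) / 0.498 +
          conj iota4 * frakfW c' D j 7 (bigP D ^ (0.5 : ℝ) / m) / 0.5‖
      ≤ ‖conj iota3 * frakfW c' D j 6 (bigP D ^ (0.498 : ℝ) / m) / 0.498‖ +
          ‖conj iota4 * frakfW c' D j 7 (bigP D ^ (0.5 : ℝ) / m) / 0.5‖ := norm_add_le _ _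
    _ = ‖conj iota3‖ * ‖frakfW c' D j 6 (bigP D ^ (0.498 : ℝ) / m)‖ / 0.498 +
          ‖conj iota4‖ * ‖frakfW c' D j 7 (bigP D ^ (0.5 : ℝ) / m)‖ / 0.5 := by
        rw [norm_div, norm_mul, n498, norm_div, norm_mul, n5]
    _ ≤ 1.25 * 29 / 0.498 + 2.3 * 29 / 0.5 := by gcongr
    _ = 29 * (1.25 / 0.498 + 2.3 / 0.5) := by ring

end Bridge

/-! ## The `(d,r)`-sum of `S_j(𝐚₁₂,𝐚₂₅)` re-indexed by `n = dr` -/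

section Identities

variable (c' : ℝ) {D : ℕ} [NeZero D] (χ : DirichletCharacter ℂ D)

omit [NeZero D] in
/-- `|μ(r)| = [r squarefree]` (as a complex-cast natural number; the weight `|μ(r)|` of Prop. 7.1).
[cite: Zhang2022LandauSiegel, §7 Prop. 7.1 p.33] -/
theorem natAbs_moebius_eq_ite (r : ℕ) :
    ((ArithmeticFunction.moebius r).natAbs : ℂ) = if Squarefree r then 1 else 0 := by
  split_ifs with h
  · rw [ArithmeticFunction.moebius_apply_of_squarefree h, Int.natAbs_pow, Int.natAbs_neg,
      Int.natAbs_one, one_pow, Nat.cast_one]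
  · rw [ArithmeticFunction.moebius_eq_zero_of_not_squarefree h]; simp

omit [NeZero D] in
/-- A real (quadratic) character is fixed by complex conjugation (`χ` real primitive, §2 p.4).
[cite: Zhang2022LandauSiegel, §2 p.4] -/
theorem conj_chi_of_isQuadratic {χ : DirichletCharacter ℂ D} (hq : χ.IsQuadratic) (a : ZMod D) :
    conj (χ a) = χ a := by
  rcases hq a with h | h | h <;> simp [h]

omit [NeZero D] in
/-- For a real character, `χ(a)² = |χ(a)|` (used in "`|χ(d)||μχ(r)|`", §12 p.71). [cite: Zhang2022LandauSiegel, §12 (12.12) p.71] -/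
theorem chi_mul_self_of_isQuadratic {χ : DirichletCharacter ℂ D} (hq : χ.IsQuadratic) (a : ZMod D) :
    χ a * χ a = (‖χ a‖ : ℂ) := by
  rcases hq a with h | h | h <;> simp [h]

omit [NeZero D] in
/-- **The `n`-sum of `S_j(𝐚₁₂,𝐚₂₅)` at `(d,r)` is `χ(dr)·sum122(d,r)`**: with `𝐚₂₅(n) = conj(χ(n)ϰ₁₃(n))`
and `χ` real, `Σ_n 𝐚₂₅(drn)ξ₀ⱼ(n;d,r)/n = χ(dr)Σ_l χ(l)ϰ̄₁₃(drl)ξ₀ⱼ(l;d,r)/l` — Lemma 12.2's sum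
`Typed.Sec12B.sum122` (the truncations `⌈PT⁻²⌉` of `S_j` and `⌈P″₂⌉` of `sum122` agree: `ϰ₁₃` vanishes
from `P″₂ ≤ PT⁻²` on, `𝓛 ≥ 3`). [cite: Zhang2022LandauSiegel, §12 (12.12) p.71, Lemma 12.2 p.69] -/
theorem nsum_a25_eq_sum122 (hq : χ.IsQuadratic) (hD3 : 3 ≤ Real.log D) (j : ℕ) {a25 : ℕ → ℂ}
    (ha25 : ∀ n, a25 n = conj (χ (n : ZMod D) * vk13 D n)) {d r : ℕ} (hd : 1 ≤ d) (hr : 1 ≤ r) :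
    ∑ n ∈ Finset.Ico 1 (Nsupp D), a25 (d * r * n) * xiZero c' D j n d r / (n : ℂ) =
      χ ((d * r : ℕ) : ZMod D) * Sec12B.sum122 c' χ j d r := by
  rw [Sec12B.sum122, Finset.mul_sum]
  have hsub : Finset.Ico 1 ⌈P2pp D⌉₊ ⊆ Finset.Ico 1 (Nsupp D) :=
    Finset.Ico_subset_Ico_right (Sec12D.ceil_P2pp_le_Nsupp hD3)
  have hdr : 1 ≤ d * r := Nat.one_le_iff_ne_zero.mpr (Nat.mul_ne_zero (by omega) (by omega))
  have hz : ∀ n ∈ Finset.Ico 1 (Nsupp D), n ∉ Finset.Ico 1 ⌈P2pp D⌉₊ →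
      χ ((d * r : ℕ) : ZMod D) *
        (χ (n : ZMod D) * conj (vk13 D (d * r * n)) * xiZero c' D j n d r / (n : ℂ)) = 0 := by
    intro n hn hn'
    rw [Finset.mem_Ico] at hn
    have hnP : ⌈P2pp D⌉₊ ≤ n := by
      by_contra h
      exact hn' (Finset.mem_Ico.mpr ⟨hn.1, not_le.mp h⟩)
    have hle : P2pp D ≤ ((d * r * n : ℕ) : ℝ) := by
      have h1 : P2pp D ≤ n := (Nat.le_ceil _).trans (by exact_mod_cast hnP)
      refine h1.trans ?_
      exact_mod_cast Nat.le_mul_of_pos_left n hdr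
    rw [Sec12D.vk13_eq_zero_of_le hle]; simp
  rw [Finset.sum_subset hsub hz]
  refine Finset.sum_congr rfl fun n _ => ?_
  rw [ha25]
  simp only [Nat.cast_mul, map_mul, conj_chi_of_isQuadratic hq]
  ring

open scoped Classical in
/-- **`S_j(𝐚₁₂,𝐚₂₅)` restricted to a range, re-indexed by `n = dr`**: for `χ` real, `𝐚₂₅ = conj(χϰ₁₃)`,
`𝓛 ≥ 3`, and a range `R` below the truncation `⌈PT⁻²⌉`:
`S_j(𝐚₁₂,𝐚₂₅)|_R = Σ_{n: R(n)} Σ_{r∣n} [r sqfree]·(|χ(n)|λ₀ⱼ(n)/n)φ(r)⁻¹·M(n)·sum122(n/r, r)` with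
`M(n) = ῑ₃Σ_mχ(m)ϰ₃(nm)m^{β_j−1} + ῑ₄Σ_mχ(m)ϰ₂(nm)m^{β_j−1}` ((9.2): `𝐚₁₂(nm) = χ(n)χ(m)(ῑ₃ϰ₃ + ῑ₄ϰ₂)(nm)`,
`χ(n)² = |χ(n)|`; substitution `n = dr` by `Skeleton.sum_box_ite_eq_sum_divisors`).
[cite: Zhang2022LandauSiegel, §12 (12.12) p.71, tex L3600–L3605] -/
theorem SjOn_a12_a25_eq_divisor_sum (hq : χ.IsQuadratic) (hD3 : 3 ≤ Real.log D) (j : ℕ)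
    {a25 : ℕ → ℂ} (ha25 : ∀ n, a25 n = conj (χ (n : ZMod D) * vk13 D n)) (R : ℕ → Prop)
    (hR : ∀ n, R n → n < Nsupp D) :
    SjOn c' D j (a12 χ) a25 R =
      ∑ n ∈ (Finset.Ico 1 (Nsupp D)).filter (fun n => R n), ∑ r ∈ n.divisors,
        (if Squarefree r then
          (‖χ (n : ZMod D)‖ : ℂ) * lamZero c' D j n / (n : ℂ) / (Nat.totient r : ℂ) *
            (conj iota3 * (∑ m ∈ Finset.Ico 1 (Nsupp D),
                χ (m : ZMod D) * vk3 D (n * m) / (m : ℂ) ^ (1 - betaJ c' D j)) +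
              conj iota4 * (∑ m ∈ Finset.Ico 1 (Nsupp D),
                χ (m : ZMod D) * vk2 D (n * m) / (m : ℂ) ^ (1 - betaJ c' D j))) *
            Sec12B.sum122 c' χ j (n / r) r else 0) := by
  classical
  unfold SjOn
  rw [sum_box_ite_eq_sum_divisors (Nsupp D) R hR _]
  refine Finset.sum_congr rfl fun n hn => Finset.sum_congr rfl fun r hr => ?_
  have hn0 : n ≠ 0 := by
    have := (Finset.mem_Ico.mp (Finset.mem_filter.mp hn).1).1; omega
  have hrd : r ∣ n := Nat.dvd_of_mem_divisors hr
  have hr0 : r ≠ 0 := Nat.pos_iff_ne_zero.mp (Nat.pos_of_mem_divisors hr)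
  have hdr : n / r * r = n := Nat.div_mul_cancel hrd
  have hd1 : 1 ≤ n / r := Nat.div_pos (Nat.le_of_dvd (Nat.pos_of_ne_zero hn0) hrd)
    (Nat.pos_of_ne_zero hr0)
  rw [Section9FrontEndExact.msum_eq χ c' j (n / r * r),
    nsum_a25_eq_sum122 c' χ hq hD3 j ha25 hd1 (Nat.one_le_iff_ne_zero.mpr hr0), hdr,
    natAbs_moebius_eq_ite]
  split_ifs with hsq
  · have hsq' := chi_mul_self_of_isQuadratic hq (n : ZMod D)
    have hnC : (n : ℂ) ≠ 0 := by exact_mod_cast hn0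
    have hφ : (Nat.totient r : ℂ) ≠ 0 := by
      exact_mod_cast (Nat.totient_pos.mpr (Nat.pos_of_ne_zero hr0)).ne'
    rw [← hsq']
    field_simp
  · simp

/-- **The printed main term of (12.12) as an `n`-sum**:
`main1212sum = L′(1,χ)²b*β_{j+1}β_{j+2}·Σ_{1≤n<⌈P^{0.496}⌉}|χ(n)|λ₀ⱼ(n)φ(n)⁻¹F_pr(n)`,
`F_pr(n) = ῑ₃𝓕_{j6}(P^{0.498}/n)/0.498 + ῑ₄𝓕_{j7}(P^{0.5}/n)/0.5`. [cite: Zhang2022LandauSiegel, §12 (12.12) p.71] -/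
theorem main1212sum_eq_sum (j : ℕ) :
    main1212sum c' χ j =
      deriv χ.LFunction 1 ^ 2 * bstar * (betaJ c' D (j + 1) * betaJ c' D (j + 2)) *
        ∑ n ∈ Finset.Ico 1 ⌈bigP D ^ (0.496 : ℝ)⌉₊,
          (‖χ (n : ZMod D)‖ : ℂ) * lamZero c' D j n / (Nat.totient n : ℂ) *
            (conj iota3 * frakfW c' D j 6 (bigP D ^ (0.498 : ℝ) / n) / 0.498 +
              conj iota4 * frakfW c' D j 7 (bigP D ^ (0.5 : ℝ) / n) / 0.5) := by
  rw [main1212sum, winSum_zero_eq_lamAvg_one, Sec10C.lamAvg, Nat.ceil_one]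

/-! ## The weight sums -/

omit [NeZero D] in
/-- `Σ_{1 ≤ n ≤ X} (n/φ(n))⁷/n ≤ 1 + e²⁵⁶(1 + log X)` (`X ≥ 1`; the tree's `sum_ratio_pow_div_le`).
[cite: HallTenenbaum1988, §0.2] -/
theorem sum_Icc_ratio7_le' {X : ℕ} (hX : 1 ≤ X) :
    ∑ n ∈ Finset.Icc 1 X, ((n : ℝ) / Nat.totient n) ^ 7 / n ≤
      1 + Real.exp 256 * (1 + Real.log X) := by
  rw [Finset.Icc_eq_cons_Ioc hX, Finset.sum_cons]
  have h1 : (((1 : ℕ) : ℝ) / Nat.totient 1) ^ 7 / ((1 : ℕ) : ℝ) = 1 := by simp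
  rw [h1]
  have h := sum_ratio_pow_div_le 7 (Y := 1) (X := X) one_pos hX
  simp only [Nat.cast_one, Real.log_one, sub_zero] at h
  have h256 : (2 : ℝ) ^ (7 + 1) = 256 := by norm_num
  rw [h256] at h
  linarith

omit [NeZero D] in
/-- **Weight of the main range**: if every `n ∈ S′` satisfies `1 ≤ n ≤ Y` (`1 ≤ Y`), then
`Σ_{n∈S′}‖a(n)‖(n/φ(n))³ ≤ 1 + e²⁵⁶(1 + log Y)`, `a(n) = |χ(n)|λ₀ⱼ(n)/n` (`|λ₀ⱼ(n)| ≤ (n/φ(n))⁴`).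
[cite: Zhang2022LandauSiegel, §12 (12.12) p.71; §8 (8.10) p.47] -/
theorem sum_weights_main_le (j : ℕ) {S' : Finset ℕ} {Y : ℝ} (hY : 1 ≤ Y)
    (hS' : ∀ n ∈ S', 1 ≤ n ∧ (n : ℝ) ≤ Y) :
    ∑ n ∈ S', ‖(‖χ (n : ZMod D)‖ : ℂ) * lamZero c' D j n / (n : ℂ)‖ * ((n : ℝ) / Nat.totient n) ^ 3 ≤
      1 + Real.exp 256 * (1 + Real.log Y) := by
  have hY0 : 0 < Y := by linarith
  have hsub : S' ⊆ Finset.Icc 1 ⌊Y⌋₊ := by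
    intro n hn
    obtain ⟨h1, h2⟩ := hS' n hn
    rw [Finset.mem_Icc]
    exact ⟨h1, Nat.le_floor h2⟩
  have hfl : 1 ≤ ⌊Y⌋₊ := Nat.le_floor (by exact_mod_cast hY)
  calc ∑ n ∈ S', ‖(‖χ (n : ZMod D)‖ : ℂ) * lamZero c' D j n / (n : ℂ)‖ * ((n : ℝ) / Nat.totient n) ^ 3
      ≤ ∑ n ∈ S', ((n : ℝ) / Nat.totient n) ^ 7 / n :=
        Finset.sum_le_sum fun n hn => norm_weight_mul_cube_le c' χ j (by have := (hS' n hn).1; omega)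
    _ ≤ ∑ n ∈ Finset.Icc 1 ⌊Y⌋₊, ((n : ℝ) / Nat.totient n) ^ 7 / n :=
        Finset.sum_le_sum_of_subset_of_nonneg hsub fun n _ _ => by positivity
    _ ≤ 1 + Real.exp 256 * (1 + Real.log (⌊Y⌋₊ : ℕ)) := sum_Icc_ratio7_le' hfl
    _ ≤ 1 + Real.exp 256 * (1 + Real.log Y) := by
        have hlog : Real.log (⌊Y⌋₊ : ℕ) ≤ Real.log Y :=
          Real.log_le_log (by exact_mod_cast hfl) (Nat.floor_le hY0.le)
        have := Real.exp_pos (256 : ℝ)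
        nlinarith

end Identities

end Literature.NumberTheory.LFunctions.Zhang2022.Typed.Sec12C
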